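import Summits.AtomisticToContinuum.Crystallization.Theorems.FreeSplittingCertificatesStrictSplittingRuleP1FluxFormTranslate
import Summits.AtomisticToContinuum.Crystallization.Theorems.FreeSplittingCertificatesStrictSplittingRuleP1CellDiam

/-!
# `StrictSplittingRule` (stmt-AtomisticToContinuum-12560): THE CELL FLUX FORM VANISHES OFF A BOX OF CELLS — the `hCELLS` bookkeeping hypothesis of the endpoint (P1 interpolant object, part 63)

Route `FreeSplittingCertificates`, crux r3 `StrictSplittingRule` (H12⋆ = `stub_coreJointCoercive`), unit b2b-freesplit-B gen 33.
VALUE = kernel discharge of the index-set hypothesis `hCELLS` of `nearLedger_of_finite` / `coreJointCoercive_of_certificates` (parts 59/60): the re-centred cell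
flux form `p1FluxQuad₀ S₁ S₂ … y_p T W` (part 46) is ZERO for every cell `T` outside an explicit BOX of cells around the base site `p`, for every vertex-value argument `W`:
* `fpFluxPre_eq_zero_of_ge` / `fpFluxProfile_eq_zero_of_ge` — the interface profile `4χχ′|y|⁻²ᵏ` vanishes outside the outer sphere `|y|² ≥ S₂` (`fpSmoothstep1 = 0` off `(0,1)`);
* `p1FluxQuad₀_eq_zero_of_far` — if every point of the real cell is at squared distance `≥ S₂` from `y₀`, the three coefficient integrals `A₀, B₀, C₀` vanish, hence the form;
* `far_of_vertex_coord` — a cell one of whose vertices is `≥ R + 2(2|a|+|h|)` away from `y₀` IN ONE COORDINATE lies outside the ball of radius `R` (`P1CellDiam`);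
* **`p1FluxQuad₀_eq_zero_of_not_mem_box`** — on `3a/4 ≤ h ≤ 9a/10` with `R₂ ≤ (27/5)a`: for `T = (n, π)` with `|n.1 − p.1| > 15` or `|n.2.1 − p.2.1| > 20` or `|n.2.2 − p.2.2| > 14`
  the form at `y_p` vanishes (third / first / second coordinate of `hcpSite`), i.e. `hCELLS` holds with
  `CELLS p = (Icc (p.1−15) (p.1+15) ×ˢ Icc (p.2.1−20) (p.2.1+20) ×ˢ Icc (p.2.2−14) (p.2.2+14)) ×ˢ univ`.
NOT a proof of H12⋆, NOT summit progress.  [folklore]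
-/

noncomputable section

open Set Function Metric MeasureTheory Filter Topology
open scoped BigOperators NNReal ENNReal Classical

namespace Summit.AtomisticToContinuum.Crystallization.Theorems.StrictSplittingRuleBirth

open Literature.MathematicalPhysics.StatisticalMechanics
open Summit.AtomisticToContinuum.Crystallization.Theorems.PalmUnimodularRigidity.LayeredLawsSelectHcp

/-! ## The interface profile vanishes outside the outer sphere -/

/-- `4χχ′ = 0` for `|y|² ≥ S₂`. -/
theorem fpFluxPre_eq_zero_of_ge {S1 S2 : ℝ} (hS12 : S1 < S2) {y : Fin 3 → ℝ} (hy : S2 ≤ fpSq y) : fpFluxPre S1 S2 y = 0 := by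
  have ht : 1 ≤ (fpSq y - S1) / (S2 - S1) := by
    rw [le_div_iff₀ (sub_pos.2 hS12)]
    linarith
  simp [fpFluxPre, fpSmoothstep1_of_one_le ht]

/-- The radial profiles `g_k` vanish for `|y|² ≥ S₂`. -/
theorem fpFluxProfile_eq_zero_of_ge {S1 S2 : ℝ} (hS12 : S1 < S2) (k : ℕ) {y : Fin 3 → ℝ} (hy : S2 ≤ fpSq y) : fpFluxProfile S1 S2 k y = 0 := by
  rw [fpFluxProfile, fpFluxPre_eq_zero_of_ge hS12 hy, zero_mul]

/-! ## A cell outside the outer sphere has zero flux form -/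

/-- **If every point of the real cell `T` is at squared distance `≥ S₂` from `y₀`, the re-centred cell flux form vanishes** (for every vertex-value argument). -/
theorem p1FluxQuad₀_eq_zero_of_far {S1 S2 : ℝ} (hS12 : S1 < S2) (ca cb cc cn a h : ℝ) (y₀ : Fin 3 → ℝ) (i : (ℤ × ℤ × ℤ) × Fin 6)
    (hfar : ∀ y ∈ p1RealCell a h i, S2 ≤ fpSq (y - y₀)) (W : Fin 4 → Fin 3 → ℝ) :
    p1FluxQuad₀ S1 S2 ca cb cc cn a h y₀ i W = 0 := by
  have hA : ∀ m₁ m₂, p1FluxA₀ S1 S2 a h y₀ i m₁ m₂ = 0 := fun m₁ m₂ =>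
    setIntegral_eq_zero_of_forall_eq_zero fun y hy => by rw [fpFluxProfile_eq_zero_of_ge hS12 3 (hfar y hy), zero_mul]
  have hB : ∀ m₁ m₂ j l, p1FluxB₀ S1 S2 a h y₀ i m₁ m₂ j l = 0 := fun m₁ m₂ j l =>
    setIntegral_eq_zero_of_forall_eq_zero fun y hy => by rw [fpFluxProfile_eq_zero_of_ge hS12 4 (hfar y hy), zero_mul]
  have hC : ∀ m j, p1FluxC₀ S1 S2 a h y₀ i m j = 0 := fun m j =>
    setIntegral_eq_zero_of_forall_eq_zero fun y hy => by rw [fpFluxProfile_eq_zero_of_ge hS12 3 (hfar y hy), zero_mul]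
  unfold p1FluxQuad₀ p1FluxCellForm₀
  simp only [hA, hB, hC, mul_zero, Finset.sum_const_zero, add_zero]

/-- **One far coordinate of one vertex puts the whole cell outside the ball**: if `R + 2(2|a|+|h|) ≤ |(y_v)_j − (y₀)_j|` for a vertex `v` of the cell `T` and a coordinate `j`,
then `R² ≤ |y − y₀|²` for every `y ∈ T` (`R ≥ 0`; `abs_sub_vertex_le_of_mem_p1RealCell`). -/
theorem far_of_vertex_coord {a h : ℝ} (ha : a ≠ 0) (hh : h ≠ 0) {i : (ℤ × ℤ × ℤ) × Fin 6} (y₀ : Fin 3 → ℝ) {R : ℝ} (hR : 0 ≤ R)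
    (m : Fin 4) (j : Fin 3) (hv : R + 2 * (2 * |a| + |h|) ≤ |hcpSite a h (i.1 + p1VertOff (p1Par i.1) i.2 m) j - y₀ j|)
    {y : Fin 3 → ℝ} (hy : y ∈ p1RealCell a h i) : R ^ 2 ≤ fpSq (y - y₀) := by
  have h1 := abs_sub_vertex_le_of_mem_p1RealCell ha hh hy m j
  have h2 : R ≤ |y j - y₀ j| := by
    have := abs_sub_abs_le_abs_sub (hcpSite a h (i.1 + p1VertOff (p1Par i.1) i.2 m) j - y₀ j) (hcpSite a h (i.1 + p1VertOff (p1Par i.1) i.2 m) j - y j)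
    rw [show hcpSite a h (i.1 + p1VertOff (p1Par i.1) i.2 m) j - y₀ j - (hcpSite a h (i.1 + p1VertOff (p1Par i.1) i.2 m) j - y j) = y j - y₀ j by ring] at this
    rw [abs_sub_comm] at h1
    linarith
  have h3 : R ^ 2 ≤ (y j - y₀ j) ^ 2 := by
    rw [← sq_abs (y j - y₀ j)]
    exact pow_le_pow_left₀ hR h2 2
  have h4 : (y j - y₀ j) ^ 2 ≤ fpSq (y - y₀) := by
    have e : fpSq (y - y₀) = (y 0 - y₀ 0) ^ 2 + (y 1 - y₀ 1) ^ 2 + (y 2 - y₀ 2) ^ 2 := rfl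
    rw [e]
    fin_cases j
    · show (y 0 - y₀ 0) ^ 2 ≤ _; nlinarith [sq_nonneg (y 1 - y₀ 1), sq_nonneg (y 2 - y₀ 2)]
    · show (y 1 - y₀ 1) ^ 2 ≤ _; nlinarith [sq_nonneg (y 0 - y₀ 0), sq_nonneg (y 2 - y₀ 2)]
    · show (y 2 - y₀ 2) ^ 2 ≤ _; nlinarith [sq_nonneg (y 0 - y₀ 0), sq_nonneg (y 1 - y₀ 1)]
  exact h3.trans h4

/-! ## The box of cells -/
set_option maxHeartbeats 400000 in
/-- **THE CELL FLUX FORM AT `y_p` VANISHES OFF THE BOX** `|n.1 − p.1| ≤ 15, |n.2.1 − p.2.1| ≤ 20, |n.2.2 − p.2.2| ≤ 14` (on `3a/4 ≤ h ≤ 9a/10`, `0 < R₁ < R₂ ≤ (27/5)a`):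
the `hCELLS` hypothesis of parts 59/60 with `CELLS p = (Icc ×ˢ Icc ×ˢ Icc) ×ˢ univ`.  NOT a proof of H12⋆, NOT summit progress. -/
theorem p1FluxQuad₀_eq_zero_of_not_mem_box {a h : ℝ} (ha : 0 < a) (hlo : 3 / 4 * a ≤ h) (hhi : h ≤ 9 / 10 * a)
    {R1 R2 : ℝ} (hR1 : 0 < R1) (hR12 : R1 < R2) (hR2 : R2 ≤ 27 / 5 * a) (p : ℤ × ℤ × ℤ) (i : (ℤ × ℤ × ℤ) × Fin 6)
    (hi : i ∉ ((Finset.Icc (p.1 - 15) (p.1 + 15) ×ˢ (Finset.Icc (p.2.1 - 20) (p.2.1 + 20) ×ˢ Finset.Icc (p.2.2 - 14) (p.2.2 + 14))) ×ˢ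
      (Finset.univ : Finset (Fin 6))))
    (ca cb cc cn : ℝ) (W : Fin 4 → Fin 3 → ℝ) :
    p1FluxQuad₀ (R1 ^ 2) (R2 ^ 2) ca cb cc cn a h (fun k => hcpSite a h p k) i W = 0 := by
  have hh : 0 < h := lt_of_lt_of_le (by positivity) hlo
  have hS12 : R1 ^ 2 < R2 ^ 2 := pow_lt_pow_left₀ hR12 hR1.le two_ne_zero
  have hR20 : 0 ≤ R2 := (hR1.trans hR12).le
  have hD : 2 * (2 * |a| + |h|) ≤ 29 / 5 * a := by
    rw [abs_of_pos ha, abs_of_pos hh]; linarith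
  -- the base of the cell is outside the box in one of the three index coordinates
  obtain ⟨n, π⟩ := i
  have hout : 15 < |n.1 - p.1| ∨ 20 < |n.2.1 - p.2.1| ∨ 14 < |n.2.2 - p.2.2| := by
    by_contra hc
    simp only [not_or, not_lt] at hc
    obtain ⟨h1, h2, h3⟩ := hc
    apply hi
    simp only [Finset.mem_product, Finset.mem_Icc, Finset.mem_univ, and_true]
    rw [abs_le] at h1 h2 h3
    refine ⟨⟨by linarith [h1.1], by linarith [h1.2]⟩, ⟨by linarith [h2.1], by linarith [h2.2]⟩, ⟨by linarith [h3.1], by linarith [h3.2]⟩⟩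
  -- the vertex `m = 0` and its corner offset
  set c : ℤ × ℤ × ℤ := p1VertOff (p1Par n) π 0 with hc
  obtain ⟨hc0, hc1, hc2⟩ := p1VertOff_mem (p1Par n) π 0
  have hlab : ∀ z : ℤ, (haggLabel alternatingHagg z : ℝ) = 0 ∨ (haggLabel alternatingHagg z : ℝ) = 1 := by
    intro z
    rcases Int.even_or_odd z with hz | hz
    · left; rw [haggLabel_alternating_of_even hz]; simp
    · right; rw [haggLabel_alternating_of_odd hz]; simp
  -- casts of the corner offset and the labels
  have hcc0 : (c.1 : ℝ) = 0 ∨ (c.1 : ℝ) = 1 := by rw [hc]; rcases hc0 with h0 | h0 <;> simp [h0]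
  have hcc1 : (c.2.1 : ℝ) = 0 ∨ (c.2.1 : ℝ) = 1 := by rw [hc]; rcases hc1 with h0 | h0 <;> simp [h0]
  have hcc2 : (c.2.2 : ℝ) = 0 ∨ (c.2.2 : ℝ) = 1 := by rw [hc]; rcases hc2 with h0 | h0 <;> simp [h0]
  have h173 : (173 / 100 : ℝ) ≤ √3 := by
    rw [show (173 / 100 : ℝ) = √((173 / 100) ^ 2) by rw [Real.sqrt_sq (by norm_num)]]
    exact Real.sqrt_le_sqrt (by norm_num)
  have hv : (n, π).1 + p1VertOff (p1Par (n, π).1) (n, π).2 0 = n + c := rfl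
  refine p1FluxQuad₀_eq_zero_of_far hS12 ca cb cc cn a h _ (n, π) (fun y hy => ?_) W
  rcases hout with hk | hrest
  · -- third coordinate: (y_v)_2 − (y_p)_2 = (Δk + c.1)·h, |Δk| ≥ 16
    refine far_of_vertex_coord ha.ne' hh.ne' _ hR20 0 2 ?_ hy
    rw [hv, hcpSite_apply_two, hcpSite_apply_two]
    have hk' : (16 : ℝ) ≤ |((n.1 : ℝ) - p.1)| := by
      have : (16 : ℤ) ≤ |n.1 - p.1| := hk
      exact_mod_cast this
    have e : (((n + c).1 : ℤ) : ℝ) * h - (p.1 : ℝ) * h = ((((n.1 : ℝ) - p.1) + c.1)) * h := by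
      push_cast [Prod.fst_add]; ring
    rw [e, abs_mul, abs_of_pos hh]
    have hin : (15 : ℝ) ≤ |((n.1 : ℝ) - p.1) + c.1| := by
      rcases hcc0 with h0 | h0 <;> rw [h0, le_abs] <;> rcases le_or_gt 0 ((n.1 : ℝ) - p.1) with hs | hs
      · left; rw [abs_of_nonneg hs] at hk'; linarith
      · right; rw [abs_of_neg hs] at hk'; linarith
      · left; rw [abs_of_nonneg hs] at hk'; linarith
      · right; rw [abs_of_neg hs] at hk'; linarith
    have hm := mul_le_mul_of_nonneg_right hin hh.le
    linarith [abs_of_pos hh, abs_of_pos ha]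
  · by_cases hJ' : 14 < |n.2.2 - p.2.2|
    · -- second coordinate: (y_v)_1 − (y_p)_1 = (a√3/2)(Δj + c.2.2 + Δlabel/3), |Δj| ≥ 15
      refine far_of_vertex_coord ha.ne' hh.ne' _ hR20 0 1 ?_ hy
      rw [hv, hcpSite_apply_one, hcpSite_apply_one]
      have hJr : (15 : ℝ) ≤ |((n.2.2 : ℝ) - p.2.2)| := by
        have : (15 : ℤ) ≤ |n.2.2 - p.2.2| := hJ'
        exact_mod_cast this
      have e : a * √3 / 2 * ((((n + c).2.2 : ℤ) : ℝ) + haggLabel alternatingHagg (n + c).1 / 3) -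
          a * √3 / 2 * ((p.2.2 : ℝ) + haggLabel alternatingHagg p.1 / 3) =
          a * √3 / 2 * ((((n.2.2 : ℝ) - p.2.2) + c.2.2) + ((haggLabel alternatingHagg (n + c).1 : ℝ) - haggLabel alternatingHagg p.1) / 3) := by
        push_cast [Prod.snd_add]; ring
      rw [e, abs_mul, abs_of_pos (by positivity : (0 : ℝ) < a * √3 / 2)]
      have hin : (13 : ℝ) ≤ |(((n.2.2 : ℝ) - p.2.2) + c.2.2) + ((haggLabel alternatingHagg (n + c).1 : ℝ) - haggLabel alternatingHagg p.1) / 3| := by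
        rcases hcc2 with h0 | h0 <;> rcases hlab (n + c).1 with l1 | l1 <;> rcases hlab p.1 with l2 | l2 <;>
          rw [h0, l1, l2, le_abs] <;> rcases le_or_gt 0 ((n.2.2 : ℝ) - p.2.2) with hs | hs <;>
          first
          | (left; rw [abs_of_nonneg hs] at hJr; linarith)
          | (right; rw [abs_of_neg hs] at hJr; linarith)
      have hm := mul_le_mul_of_nonneg_right hin (by positivity : (0 : ℝ) ≤ a * √3 / 2)
      nlinarith [hm, h173, hD, hR2, ha]
    · -- first coordinate: (y_v)_0 − (y_p)_0 = a(Δi + c.2.1 + (Δj + c.2.2)/2 + Δlabel/2), |Δi| ≥ 21, |Δj| ≤ 14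
      have hJle : |n.2.2 - p.2.2| ≤ 14 := not_lt.1 hJ'
      have hI : 20 < |n.2.1 - p.2.1| := by
        rcases hrest with hI | hJ
        · exact hI
        · exact absurd hJ hJ'
      refine far_of_vertex_coord ha.ne' hh.ne' _ hR20 0 0 ?_ hy
      rw [hv, hcpSite_apply_zero, hcpSite_apply_zero]
      have hIr : (21 : ℝ) ≤ |((n.2.1 : ℝ) - p.2.1)| := by
        have : (21 : ℤ) ≤ |n.2.1 - p.2.1| := hI
        exact_mod_cast this
      have hJr : |((n.2.2 : ℝ) - p.2.2)| ≤ 14 := by exact_mod_cast hJle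
      have e : a * ((((n + c).2.1 : ℤ) : ℝ) + (((n + c).2.2 : ℤ) : ℝ) / 2 + haggLabel alternatingHagg (n + c).1 / 2) -
          a * ((p.2.1 : ℝ) + (p.2.2 : ℝ) / 2 + haggLabel alternatingHagg p.1 / 2) =
          a * ((((n.2.1 : ℝ) - p.2.1) + c.2.1) + (((n.2.2 : ℝ) - p.2.2) + c.2.2) / 2 +
            ((haggLabel alternatingHagg (n + c).1 : ℝ) - haggLabel alternatingHagg p.1) / 2) := by
        push_cast [Prod.snd_add, Prod.fst_add]; ring
      rw [e, abs_mul, abs_of_pos ha]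
      have hin : (12 : ℝ) ≤ |(((n.2.1 : ℝ) - p.2.1) + c.2.1) + (((n.2.2 : ℝ) - p.2.2) + c.2.2) / 2 +
          ((haggLabel alternatingHagg (n + c).1 : ℝ) - haggLabel alternatingHagg p.1) / 2| := by
        rw [abs_le] at hJr
        obtain ⟨hJ1, hJ2⟩ := hJr
        rcases hcc1 with h0 | h0 <;> rcases hcc2 with h0' | h0' <;> rcases hlab (n + c).1 with l1 | l1 <;> rcases hlab p.1 with l2 | l2 <;>
          rw [h0, h0', l1, l2, le_abs] <;> rcases le_or_gt 0 ((n.2.1 : ℝ) - p.2.1) with hs | hs <;>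
          first
          | (left; rw [abs_of_nonneg hs] at hIr; linarith)
          | (right; rw [abs_of_neg hs] at hIr; linarith)
      have hm := mul_le_mul_of_nonneg_right hin ha.le
      linarith [abs_of_pos hh, abs_of_pos ha]

end Summit.AtomisticToContinuum.Crystallization.Theorems.StrictSplittingRuleBirth

end
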